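import Summits.MatrixMultiplication.OmegaCensus.DominoZpZpKit
import HarnessLib

/-!
# Structural cover argument for part size `4` on `ZMod p × ZMod p` (generic in the odd prime `p`): the core

ω-census `pub-omega`, family (b3), seat pub-omega-group gen 22.  Framing: lottery ticket; floor = certified bounds/negative
ranges.  VALUE: replaces, for part size `d = 4`, the kernel ENUMERATION of all value functions on `ZMod p × ZMod p`
(`DominoZpZpEnum/Cover.lean`: tens of thousands of nodes and a full certified line table per prime) by a STRUCTURAL
argument; the table side is `DominoZpZpStructFour.lean`; NOT progress on ω.

**Theorem (`exists_goodQ`).**  Let `p` be an odd prime and `u₀, u₁, u₂, u₃` points of `ZMod p × ZMod p` (a value function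
of sum `4` is the counting function of such a tuple, `exists_tuple_of_sum_eq`).  After a permutation of the indices some
line direction `j ≤ p` (`lineDir`) gives values `(a₀, a₁, a₂, a₃)` with `a₀ = a₁` that are NOT of the excluded shape
`a₂, a₃ ≠ a₀`, `a₂ ≠ a₃`, `a₂ + a₃ = 2a₀`, `a₀ ≠ 0`:
* if two of the points coincide (`exists_goodQ_of_eq`), collapse a third one onto them, or the third already agrees;
* otherwise (`exists_goodQ_of_ne`, needs only `u₁ ≠ u₂`) collapse the pairs `{0,1}`, `{2,3}`, `{0,2}`, `{1,3}` in turn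
  (`exists_lineDir_eq`); if all four collapses had the excluded shape, then in each complementary pairing the
  two directions differ (the other pair is not collapsed) and their kernels meet in `0` (`eq_zero_of_lineDir_pair`),
  so   `u₂ + u₃ = u₀ + u₁` and `u₁ + u₃ = u₀ + u₂`, whence `2(u₂ − u₁) = 0` and `u₁ = u₂` (`p` odd): contradiction.
The excluded shape `{a−k, a, a, a+k}`, `a ≠ 0`, is exactly the family of repeated multisets of size `4` passing the
cyclotomic unit test (it can carry no line certificate); for `p ∈ {13, 17, 23, 29, 31}` every other repeated multiset
fails it (exact norms, `pub-omega-group-g22/code/classify4.py`).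
-/

namespace Summit.MatrixMultiplication.OmegaCensus

open Finset

namespace ZpZpDomino

/-! ## Multisets of points as tuples -/

section Tuple

variable {α : Type*} [Fintype α] [DecidableEq α]

/-- A value function of sum `n` on a finite type is the counting function of an `n`-tuple of points. [folklore] -/
theorem exists_tuple_of_sum_eq : ∀ (n : ℕ) (H : α → ℕ), ∑ a, H a = n →
    ∃ u : Fin n → α, ∀ a, H a = ∑ i : Fin n, if u i = a then 1 else 0
  | 0, H, h => by
    refine ⟨Fin.elim0, fun a => ?_⟩
    have ha : H a = 0 := by
      have := (Finset.sum_eq_zero_iff.1 h) a (mem_univ a)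
      exact this
    simp [ha]
  | n + 1, H, h => by
    classical
    have hne : ∑ a, H a ≠ 0 := by rw [h]; exact Nat.succ_ne_zero n
    obtain ⟨a₀, -, ha₀⟩ := Finset.exists_ne_zero_of_sum_ne_zero hne
    set H' : α → ℕ := Function.update H a₀ (H a₀ - 1) with hH'
    have hsum' : ∑ a, H' a = n := by
      have e1 : ∑ a, H' a = (H a₀ - 1) + ∑ a ∈ univ.erase a₀, H a := by
        rw [hH', Finset.sum_update_of_mem (mem_univ a₀), sdiff_singleton_eq_erase]
      have e2 : ∑ a, H a = H a₀ + ∑ a ∈ univ.erase a₀, H a :=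
        (Finset.add_sum_erase univ H (mem_univ a₀)).symm
      have hpos : 1 ≤ H a₀ := Nat.pos_of_ne_zero ha₀
      omega
    obtain ⟨u', hu'⟩ := exists_tuple_of_sum_eq n H' hsum'
    refine ⟨Fin.cons a₀ u', fun a => ?_⟩
    rw [Fin.sum_univ_succ, Fin.cons_zero]
    simp only [Fin.cons_succ]
    rw [← hu' a, hH']
    by_cases haa : a = a₀
    · subst haa
      rw [Function.update_self, if_pos rfl]
      have hpos : 1 ≤ H a := Nat.pos_of_ne_zero ha₀
      omega
    · rw [Function.update_of_ne haa, if_neg (Ne.symm haa)]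
      simp

/-- The fibre count of a tuple pushed through a map: `Σ_{w : f w = v} #{i : u i = w} = #{i : f (u i) = v}`. [folklore] -/
theorem sum_filter_tuple_count {β : Type*} [DecidableEq β] {n : ℕ} (u : Fin n → α) (f : α → β) (v : β) :
    ∑ w ∈ univ.filter (fun w => f w = v), (∑ i : Fin n, if u i = w then 1 else 0) =
      ∑ i : Fin n, if f (u i) = v then 1 else 0 := by
  rw [Finset.sum_comm]
  refine Finset.sum_congr rfl fun i _ => ?_
  rw [Finset.sum_ite_eq (univ.filter fun w => f w = v) (u i) (fun _ => (1 : ℕ))]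
  simp only [mem_filter, mem_univ, true_and]

end Tuple

/-! ## Directions: collapsing a pair, and two directions pin a point -/

section Directions

variable {p : ℕ} [Fact p.Prime]

/-- Direction `0` is the first coordinate. [folklore] -/
theorem lineDir_zero_apply (x : ZMod p × ZMod p) : lineDir p 0 x = x.1 := by
  simp [lineDir, dirFst, dirSnd]

/-- Direction `k.val + 1` is `k·x₁ + x₂`. [folklore] -/
theorem lineDir_succ_apply (k : ZMod p) (x : ZMod p × ZMod p) : lineDir p (k.val + 1) x = k * x.1 + x.2 := by
  simp [lineDir, dirFst, dirSnd]

/-- **Any two points are collapsed by some direction.** [folklore] -/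
theorem exists_lineDir_eq (u w : ZMod p × ZMod p) : ∃ j < p + 1, lineDir p j u = lineDir p j w := by
  by_cases h1 : u.1 = w.1
  · exact ⟨0, Nat.succ_pos p, by rw [lineDir_zero_apply, lineDir_zero_apply, h1]⟩
  · have hδ : u.1 - w.1 ≠ 0 := sub_ne_zero.2 h1
    set k : ZMod p := -(u.2 - w.2) * (u.1 - w.1)⁻¹ with hk
    refine ⟨k.val + 1, Nat.succ_lt_succ (ZMod.val_lt k), ?_⟩
    rw [lineDir_succ_apply, lineDir_succ_apply]
    have e : k * (u.1 - w.1) = -(u.2 - w.2) := by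
      rw [hk, mul_assoc, inv_mul_cancel₀ hδ, mul_one]
    have e2 : k * u.1 + u.2 - (k * w.1 + w.2) = k * (u.1 - w.1) + (u.2 - w.2) := by ring
    rw [← sub_eq_zero, e2, e, neg_add_cancel]

/-- **Two different directions vanish together only at `0`.** [folklore] -/
theorem eq_zero_of_lineDir_pair {j j' : ℕ} (hj : j < p + 1) (hj' : j' < p + 1) (hne : j ≠ j')
    {x : ZMod p × ZMod p} (h1 : lineDir p j x = 0) (h2 : lineDir p j' x = 0) : x = 0 := by
  -- write each direction as `0` or `k.val + 1`
  have key : ∀ {j₁ j₂ : ℕ}, j₁ < p + 1 → j₂ < p + 1 → j₁ < j₂ →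
      lineDir p j₁ x = 0 → lineDir p j₂ x = 0 → x = 0 := by
    intro j₁ j₂ hj₁ hj₂ hlt e1 e2
    obtain ⟨k₂, rfl⟩ : ∃ k, j₂ = k + 1 := ⟨j₂ - 1, by omega⟩
    have hk₂ : k₂ < p := by omega
    have e2' : ((k₂ : ℕ) : ZMod p) * x.1 + x.2 = 0 := by
      have := lineDir_succ_apply ((k₂ : ℕ) : ZMod p) x
      rw [ZMod.val_natCast, Nat.mod_eq_of_lt hk₂] at this
      rw [← this]; exact e2
    rcases Nat.eq_zero_or_pos j₁ with rfl | hpos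
    · rw [lineDir_zero_apply] at e1
      rw [e1, mul_zero, zero_add] at e2'
      exact Prod.ext e1 e2'
    · obtain ⟨k₁, rfl⟩ : ∃ k, j₁ = k + 1 := ⟨j₁ - 1, by omega⟩
      have hk₁ : k₁ < p := by omega
      have e1' : ((k₁ : ℕ) : ZMod p) * x.1 + x.2 = 0 := by
        have := lineDir_succ_apply ((k₁ : ℕ) : ZMod p) x
        rw [ZMod.val_natCast, Nat.mod_eq_of_lt hk₁] at this
        rw [← this]; exact e1
      have hkk : ((k₂ : ℕ) : ZMod p) - ((k₁ : ℕ) : ZMod p) ≠ 0 := by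
        intro e
        have e' := (ZMod.natCast_eq_natCast_iff' k₂ k₁ p).1 (sub_eq_zero.1 e)
        rw [Nat.mod_eq_of_lt hk₂, Nat.mod_eq_of_lt hk₁] at e'
        omega
      have e3 : (((k₂ : ℕ) : ZMod p) - ((k₁ : ℕ) : ZMod p)) * x.1 = 0 := by
        have : (((k₂ : ℕ) : ZMod p) - ((k₁ : ℕ) : ZMod p)) * x.1 =
            (((k₂ : ℕ) : ZMod p) * x.1 + x.2) - (((k₁ : ℕ) : ZMod p) * x.1 + x.2) := by ring
        rw [this, e1', e2', sub_zero]
      have hx1 : x.1 = 0 := (mul_eq_zero.1 e3).resolve_left hkk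
      rw [hx1, mul_zero, zero_add] at e1'
      exact Prod.ext hx1 e1'
  rcases Nat.lt_or_gt_of_ne hne with hlt | hlt
  · exact key hj hj' hlt h1 h2
  · exact key hj' hj hlt h2 h1

end Directions

/-! ## The structural core: a good direction for every `4`-tuple of points -/

section Core

variable {p : ℕ} [Fact p.Prime]

/-! A quadruple of line values `(a₀, a₁, a₂, a₃)` is GOOD if `a₀ = a₁` and it is not of the excluded shape
`(a, a, b, c)` with `b, c ≠ a`, `b ≠ c`, `b + c = 2a`, `a ≠ 0` (the unit-passing family `{a−k, a, a, a+k}`);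
written out in full in the statements below. -/

/-- Case of a repeated point: `u 0 = u 1`. [folklore] -/
theorem exists_goodQ_of_eq (u : Fin 4 → ZMod p × ZMod p) (h01 : u 0 = u 1) :
    ∃ j < p + 1, ∃ σ : Equiv.Perm (Fin 4), lineDir p j (u (σ 0)) = lineDir p j (u (σ 1)) ∧
      ¬ (lineDir p j (u (σ 2)) ≠ lineDir p j (u (σ 0)) ∧ lineDir p j (u (σ 3)) ≠ lineDir p j (u (σ 0)) ∧
        lineDir p j (u (σ 2)) ≠ lineDir p j (u (σ 3)) ∧
        lineDir p j (u (σ 2)) + lineDir p j (u (σ 3)) = lineDir p j (u (σ 0)) + lineDir p j (u (σ 0)) ∧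
        lineDir p j (u (σ 0)) ≠ 0) := by
  by_cases h2 : u 2 = u 0
  · refine ⟨0, Nat.succ_pos p, 1, ?_, ?_⟩
    · show lineDir p 0 (u 0) = lineDir p 0 (u 1)
      rw [h01]
    · show ¬ (lineDir p 0 (u 2) ≠ lineDir p 0 (u 0) ∧ _)
      rintro ⟨h, -⟩
      exact h (by rw [h2])
  · obtain ⟨j, hj, e⟩ := exists_lineDir_eq (u 0) (u 2)
    refine ⟨j, hj, 1, ?_, ?_⟩
    · show lineDir p j (u 0) = lineDir p j (u 1)
      rw [h01]
    · show ¬ (lineDir p j (u 2) ≠ lineDir p j (u 0) ∧ _)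
      rintro ⟨h, -⟩
      exact h e.symm

/-- The permutation `(0 2)(1 3)` of `Fin 4` (values `2, 3, 0, 1`). [folklore] -/
def permA : Equiv.Perm (Fin 4) := (Equiv.swap (0 : Fin 4) 2).trans (Equiv.swap (1 : Fin 4) 3)

/-- The permutation of `Fin 4` with values `1, 3, 0, 2`. [folklore] -/
def permC : Equiv.Perm (Fin 4) :=
  ((Equiv.swap (0 : Fin 4) 1).trans (Equiv.swap (0 : Fin 4) 3)).trans (Equiv.swap (0 : Fin 4) 2)

/-- Values of `permA`. [folklore] -/
theorem permA_apply : permA 0 = 2 ∧ permA 1 = 3 ∧ permA 2 = 0 ∧ permA 3 = 1 := by decide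

/-- Values of `permC`. [folklore] -/
theorem permC_apply : permC 0 = 1 ∧ permC 1 = 3 ∧ permC 2 = 0 ∧ permC 3 = 2 := by decide

/-- Values of the transposition `(1 2)`. [folklore] -/
theorem swap12_apply : Equiv.swap (1 : Fin 4) 2 0 = 0 ∧ Equiv.swap (1 : Fin 4) 2 1 = 2 ∧
    Equiv.swap (1 : Fin 4) 2 2 = 1 ∧ Equiv.swap (1 : Fin 4) 2 3 = 3 := by decide

/-- Values of the transposition `(0 2)`. [folklore] -/
theorem swap02_apply : Equiv.swap (0 : Fin 4) 2 0 = 2 ∧ Equiv.swap (0 : Fin 4) 2 1 = 1 ∧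
    Equiv.swap (0 : Fin 4) 2 2 = 0 ∧ Equiv.swap (0 : Fin 4) 2 3 = 3 := by decide

/-- **The parallelogram argument**: case `u 1 ≠ u 2`.  Collapse the pairs `{0,1}`, `{2,3}`, `{0,2}`, `{1,3}` in turn; if all
four collapses had the excluded shape, the kernels of two different directions would force `u₂ + u₃ = u₀ + u₁` and
`u₁ + u₃ = u₀ + u₂`, so `2(u₂ − u₁) = 0`. [folklore] -/
theorem exists_goodQ_of_ne (hp2 : p ≠ 2) (u : Fin 4 → ZMod p × ZMod p) (h12 : u 1 ≠ u 2) :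
    ∃ j < p + 1, ∃ σ : Equiv.Perm (Fin 4), lineDir p j (u (σ 0)) = lineDir p j (u (σ 1)) ∧
      ¬ (lineDir p j (u (σ 2)) ≠ lineDir p j (u (σ 0)) ∧ lineDir p j (u (σ 3)) ≠ lineDir p j (u (σ 0)) ∧
        lineDir p j (u (σ 2)) ≠ lineDir p j (u (σ 3)) ∧
        lineDir p j (u (σ 2)) + lineDir p j (u (σ 3)) = lineDir p j (u (σ 0)) + lineDir p j (u (σ 0)) ∧
        lineDir p j (u (σ 0)) ≠ 0) := by
  -- pair {0,1}
  obtain ⟨j₁, hj₁, e₁⟩ := exists_lineDir_eq (u 0) (u 1)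
  by_cases b₁ : lineDir p j₁ (u 2) ≠ lineDir p j₁ (u 0) ∧ lineDir p j₁ (u 3) ≠ lineDir p j₁ (u 0) ∧
      lineDir p j₁ (u 2) ≠ lineDir p j₁ (u 3) ∧
      lineDir p j₁ (u 2) + lineDir p j₁ (u 3) = lineDir p j₁ (u 0) + lineDir p j₁ (u 0) ∧ lineDir p j₁ (u 0) ≠ 0
  swap
  · exact ⟨j₁, hj₁, 1, e₁, b₁⟩
  -- pair {2,3}
  obtain ⟨j₂, hj₂, e₂⟩ := exists_lineDir_eq (u 2) (u 3)
  by_cases b₂ : lineDir p j₂ (u 0) ≠ lineDir p j₂ (u 2) ∧ lineDir p j₂ (u 1) ≠ lineDir p j₂ (u 2) ∧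
      lineDir p j₂ (u 0) ≠ lineDir p j₂ (u 1) ∧
      lineDir p j₂ (u 0) + lineDir p j₂ (u 1) = lineDir p j₂ (u 2) + lineDir p j₂ (u 2) ∧ lineDir p j₂ (u 2) ≠ 0
  swap
  · refine ⟨j₂, hj₂, permA, ?_⟩
    rw [permA_apply.1, permA_apply.2.1, permA_apply.2.2.1, permA_apply.2.2.2]
    exact ⟨e₂, b₂⟩
  have hne₁₂ : j₁ ≠ j₂ := by
    rintro rfl
    exact b₁.2.2.1 e₂
  have hx₁ : lineDir p j₁ (u 2 + u 3 - u 0 - u 1) = 0 := by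
    simp only [map_sub, map_add]
    rw [b₁.2.2.2.1, e₁]; abel
  have hx₂ : lineDir p j₂ (u 2 + u 3 - u 0 - u 1) = 0 := by
    simp only [map_sub, map_add]
    rw [← e₂, ← b₂.2.2.2.1]; abel
  have E₁ : u 2 + u 3 - u 0 - u 1 = 0 := eq_zero_of_lineDir_pair hj₁ hj₂ hne₁₂ hx₁ hx₂
  -- pair {0,2}
  obtain ⟨j₃, hj₃, e₃⟩ := exists_lineDir_eq (u 0) (u 2)
  by_cases b₃ : lineDir p j₃ (u 1) ≠ lineDir p j₃ (u 0) ∧ lineDir p j₃ (u 3) ≠ lineDir p j₃ (u 0) ∧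
      lineDir p j₃ (u 1) ≠ lineDir p j₃ (u 3) ∧
      lineDir p j₃ (u 1) + lineDir p j₃ (u 3) = lineDir p j₃ (u 0) + lineDir p j₃ (u 0) ∧ lineDir p j₃ (u 0) ≠ 0
  swap
  · refine ⟨j₃, hj₃, Equiv.swap (1 : Fin 4) 2, ?_⟩
    rw [swap12_apply.1, swap12_apply.2.1, swap12_apply.2.2.1, swap12_apply.2.2.2]
    exact ⟨e₃, b₃⟩
  -- pair {1,3}
  obtain ⟨j₄, hj₄, e₄⟩ := exists_lineDir_eq (u 1) (u 3)
  by_cases b₄ : lineDir p j₄ (u 0) ≠ lineDir p j₄ (u 1) ∧ lineDir p j₄ (u 2) ≠ lineDir p j₄ (u 1) ∧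
      lineDir p j₄ (u 0) ≠ lineDir p j₄ (u 2) ∧
      lineDir p j₄ (u 0) + lineDir p j₄ (u 2) = lineDir p j₄ (u 1) + lineDir p j₄ (u 1) ∧ lineDir p j₄ (u 1) ≠ 0
  swap
  · refine ⟨j₄, hj₄, permC, ?_⟩
    rw [permC_apply.1, permC_apply.2.1, permC_apply.2.2.1, permC_apply.2.2.2]
    exact ⟨e₄, b₄⟩
  exfalso
  have hne₃₄ : j₃ ≠ j₄ := by
    rintro rfl
    exact b₃.2.2.1 e₄
  have hx₃ : lineDir p j₃ (u 1 + u 3 - u 0 - u 2) = 0 := by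
    simp only [map_sub, map_add]
    rw [b₃.2.2.2.1, e₃]; abel
  have hx₄ : lineDir p j₄ (u 1 + u 3 - u 0 - u 2) = 0 := by
    simp only [map_sub, map_add]
    rw [← e₄, ← b₄.2.2.2.1]; abel
  have E₂ : u 1 + u 3 - u 0 - u 2 = 0 := eq_zero_of_lineDir_pair hj₃ hj₄ hne₃₄ hx₃ hx₄
  have h2 : (2 : ZMod p) • (u 2 - u 1) = 0 := by
    rw [two_smul]
    calc u 2 - u 1 + (u 2 - u 1) = (u 2 + u 3 - u 0 - u 1) - (u 1 + u 3 - u 0 - u 2) := by abel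
      _ = 0 := by rw [E₁, E₂, sub_zero]
  rcases smul_eq_zero.1 h2 with h | h
  · -- `2 ≠ 0` in `ZMod p` for the odd prime `p`
    have h' : ((2 : ℕ) : ZMod p) = 0 := by exact_mod_cast h
    rw [ZMod.natCast_eq_zero_iff] at h'
    exact hp2 ((Nat.prime_dvd_prime_iff_eq (Fact.out : p.Prime) Nat.prime_two).1 h')
  · exact h12 (sub_eq_zero.1 h).symm

/-- **Structural core**: every `4`-tuple of points of `ZMod p × ZMod p` (`p` an odd prime) has, after a permutation, a line
direction with a GOOD quadruple of values. [folklore] -/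
theorem exists_goodQ (hp2 : p ≠ 2) (u : Fin 4 → ZMod p × ZMod p) :
    ∃ j < p + 1, ∃ σ : Equiv.Perm (Fin 4), lineDir p j (u (σ 0)) = lineDir p j (u (σ 1)) ∧
      ¬ (lineDir p j (u (σ 2)) ≠ lineDir p j (u (σ 0)) ∧ lineDir p j (u (σ 3)) ≠ lineDir p j (u (σ 0)) ∧
        lineDir p j (u (σ 2)) ≠ lineDir p j (u (σ 3)) ∧
        lineDir p j (u (σ 2)) + lineDir p j (u (σ 3)) = lineDir p j (u (σ 0)) + lineDir p j (u (σ 0)) ∧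
        lineDir p j (u (σ 0)) ≠ 0) := by
  by_cases h12 : u 1 = u 2
  · obtain ⟨j, hj, σ, hσ⟩ := exists_goodQ_of_eq (fun i => u (Equiv.swap (0 : Fin 4) 2 i))
      (by show u (Equiv.swap (0 : Fin 4) 2 0) = u (Equiv.swap (0 : Fin 4) 2 1)
          rw [swap02_apply.1, swap02_apply.2.1, h12])
    exact ⟨j, hj, σ.trans (Equiv.swap (0 : Fin 4) 2), hσ⟩
  · exact exists_goodQ_of_ne hp2 u h12

end Core

end ZpZpDomino

end Summit.MatrixMultiplication.OmegaCensus
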